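import Literature.NumberTheory.EllipticCurves.BinaryQuarticDiscriminantStrata
import Mathlib.FieldTheory.IsAlgClosed.AlgebraicClosure
import Mathlib.Algebra.Polynomial.Degree.SmallDegree
import Mathlib.Algebra.Order.BigOperators.Group.Finset
import HarnessLib

/-!
# Point counts modulo `p` for the discriminant of binary quartic forms:
# `#{Δ = 0} ≤ 3p⁴ + 3p³` and `#Y(ℤ/p) ≤ 6p³` for `Y = {Δ = ∂Δ/∂e = 0}`

`Proofs` companion (theorems only) of `BinaryQuarticDiscriminantStrata.lean`. Source:
M. Bhargava, A. Shankar, *Binary quartic forms having bounded invariants, and the boundedness of the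
average rank of elliptic curves*, Ann. of Math. (2) 181 (2015) 191–242, §2.6 of the published version
(= arXiv:1006.1002v3): the uniformity estimate Thm 2.13 is proved there from Thm 2.18 (the
geometric sieve Thm 2.17 applied to "the codimension 2 subscheme `Y` of `V ≅ 𝔸⁵` defined by the
vanishing of `Δ` and `∂Δ/∂e`") and Thm 2.20 (whose proof uses "at most `3` choices for the residue
of `e₀ (mod p)` such that `p ∣ Δ`"). Both arithmetic inputs are asserted there without proof; this
file proves them as explicit point counts over `ℤ/p`:

* `card_filter_disc_eq_zero_of_abcd_le_three`: for `p ≠ 2`, `a ≢ 0`, and fixed `b, c, d`, at most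
  `3` residues `e` have `Δ ≡ 0 (mod p)`;
* `card_filter_disc_eq_zero_le`: `#{f ∈ V(ℤ/p) : Δ(f) = 0} ≤ 3p⁴ + 3p³` (`p ≥ 5`);
* `card_filter_disc_eq_zero_discDerivE_eq_zero_le`: `#Y(ℤ/p) ≤ 6p³` (`p ≥ 5`) — the point-count
  form of "`Y` has codimension `2`", which is what the proof of the geometric sieve
  ([geosieve, Thm 3.3] = Thm 2.17) consumes. It is assembled from the structure theorem of the
  companion file (`strata_of_disc_eq_zero_of_discDerivE_eq_zero`, transported to `ℤ/p` through an
  algebraic closure) and three fibre counts: `#{a = 0, Δ = 0} ≤ 3p³`,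
  `#{a ≠ 0, I = J = 0} ≤ 2p³`, `#{a ≠ 0, 8a²d = b(4ac − b²), 64a³e = (4ac − b²)²} ≤ p³`.

All counts are by projecting to three or four of the coefficients and bounding the fibres by the
number of roots of an explicit nonzero polynomial of degree `≤ 3` (`card_filter_eval_eq_zero_le`).
The companion `BinaryQuarticDiscriminantLiftProofs.lean` lifts these to `ℤ/p²`.

## References

* M. Bhargava, A. Shankar, Ann. of Math. (2) 181 (2015), §2.6, Thms 2.17–2.20 of the published
  version (= arXiv:1006.1002v3). [cite: BhargavaShankarAnnals2015, §2.6 (published numbering)]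
* M. Bhargava, *The geometric sieve and the density of squarefree values of invariant
  polynomials*, arXiv:1402.0031 (`geosieve`, cited through the source).
-/

noncomputable section

open scoped Classical

namespace Literature.NumberTheory.EllipticCurves

namespace BinaryQuartic

open Finset Polynomial

/-! ## Counting helpers -/

/-- A nonzero polynomial of degree `≤ n` over a finite field has at most `n` zeros. [folklore] -/
theorem card_filter_eval_eq_zero_le {F : Type*} [Field F] [Fintype F] [DecidableEq F] {P : F[X]}
    (hP : P ≠ 0) {n : ℕ} (hn : P.natDegree ≤ n) :
    (univ.filter fun x => P.eval x = 0).card ≤ n := by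
  calc (univ.filter fun x => P.eval x = 0).card ≤ P.roots.toFinset.card := by
        refine card_le_card fun x hx => ?_
        rw [mem_filter] at hx
        exact Multiset.mem_toFinset.mpr ((mem_roots hP).mpr hx.2)
    _ ≤ Multiset.card P.roots := Multiset.toFinset_card_le _
    _ ≤ P.natDegree := card_roots' P
    _ ≤ n := hn

section ZModP

variable {p : ℕ} [hp : Fact p.Prime]

/-- `2 ≠ 0` in `ℤ/p` for `p ≠ 2`. [folklore] -/
theorem two_ne_zero_zmod (hp2 : p ≠ 2) : (2 : ZMod p) ≠ 0 := by
  have h : ((2 : ℕ) : ZMod p) ≠ 0 := by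
    rw [Ne, ZMod.natCast_eq_zero_iff]
    exact fun h => hp2 ((Nat.prime_dvd_prime_iff_eq hp.out Nat.prime_two).mp h)
  exact_mod_cast h

/-- `3 ≠ 0` in `ℤ/p` for `p ≠ 3`. [folklore] -/
theorem three_ne_zero_zmod (hp3 : p ≠ 3) : (3 : ZMod p) ≠ 0 := by
  have h : ((3 : ℕ) : ZMod p) ≠ 0 := by
    rw [Ne, ZMod.natCast_eq_zero_iff]
    exact fun h => hp3 ((Nat.prime_dvd_prime_iff_eq hp.out Nat.prime_three).mp h)
  exact_mod_cast h

/-! ## Zeros of `Δ` modulo `p`: fibres of the coefficient projections -/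

/-- **"At most `3` choices for the residue of `e`"** (Bhargava–Shankar 2015, proof of Thm 2.20):
for `p ≠ 2` and fixed `a, b, c, d ∈ ℤ/p` with `a ≠ 0`, at most `3` values of `e` make `Δ` vanish
(`Δ` is a cubic in `e` with leading coefficient `256a³`). (For `a = b = 0` the discriminant vanishes
identically; the source tacitly excludes this.) [cite: BhargavaShankarAnnals2015, §2.6, proof of Thm 2.20 (published numbering)] -/
theorem card_filter_disc_eq_zero_of_abcd_le_three (hp2 : p ≠ 2) {a : ZMod p} (ha : a ≠ 0)
    (b c d : ZMod p) :
    (univ.filter fun f : BinaryQuartic (ZMod p) =>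
        f.a = a ∧ f.b = b ∧ f.c = c ∧ f.d = d ∧ f.disc = 0).card ≤ 3 := by
  have h256 : (256 : ZMod p) * a ^ 3 ≠ 0 := by
    refine mul_ne_zero ?_ (pow_ne_zero _ ha)
    have : (256 : ZMod p) = 2 ^ 8 := by norm_num
    rw [this]
    exact pow_ne_zero _ (two_ne_zero_zmod hp2)
  obtain ⟨P, hP0, hPdeg, hPeval⟩ : ∃ P : (ZMod p)[X], P ≠ 0 ∧ P.natDegree ≤ 3 ∧
      ∀ e, P.eval e = (⟨a, b, c, d, e⟩ : BinaryQuartic (ZMod p)).disc :=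
    ⟨C (256 * a ^ 3) * X ^ 3
        + C (-192 * a ^ 2 * b * d - 128 * a ^ 2 * c ^ 2 + 144 * a * b ^ 2 * c - 27 * b ^ 4) * X ^ 2
        + C (144 * a ^ 2 * c * d ^ 2 - 6 * a * b ^ 2 * d ^ 2 - 80 * a * b * c ^ 2 * d
            + 16 * a * c ^ 4 + 18 * b ^ 3 * c * d - 4 * b ^ 2 * c ^ 3) * X
        + C (-27 * a ^ 2 * d ^ 4 + 18 * a * b * c * d ^ 3 - 4 * a * c ^ 3 * d ^ 2
            - 4 * b ^ 3 * d ^ 3 + b ^ 2 * c ^ 2 * d ^ 2),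
      leadingCoeff_ne_zero.mp (by rw [leadingCoeff_cubic h256]; exact h256), natDegree_cubic_le,
      fun e => by simp only [disc, eval_add, eval_mul, eval_pow, eval_C, eval_X]; ring⟩
  calc _ ≤ (univ.filter fun x : ZMod p => P.eval x = 0).card := by
        refine card_le_card_of_injOn (fun f => f.e) (fun f hf => ?_) (fun f hf f' hf' h => ?_)
        · simp only [coe_filter, mem_univ, true_and, Set.mem_setOf_eq] at hf ⊢
          obtain ⟨h₁, h₂, h₃, h₄, hΔ⟩ := hf
          have : f = ⟨a, b, c, d, f.e⟩ := by ext <;> simp [h₁, h₂, h₃, h₄]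
          rw [hPeval, ← this, hΔ]
        · simp only [coe_filter, mem_univ, true_and, Set.mem_setOf_eq] at hf hf'
          ext <;> [rw [hf.1, hf'.1]; rw [hf.2.1, hf'.2.1]; rw [hf.2.2.1, hf'.2.2.1];
            rw [hf.2.2.2.1, hf'.2.2.2.1]; exact h]
    _ ≤ 3 := card_filter_eval_eq_zero_le hP0 hPdeg

/-- For `p ≠ 3` and fixed `b, c, d ∈ ℤ/p` with `b ≠ 0`, at most `2` values of `e` give a form with
`a = 0` and `Δ = 0` (at `a = 0`, `Δ` is a quadratic in `e` with leading coefficient `−27b⁴`). [folklore] -/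
theorem card_filter_disc_eq_zero_of_a_eq_zero_le_two (hp3 : p ≠ 3) {b : ZMod p} (hb : b ≠ 0)
    (c d : ZMod p) :
    (univ.filter fun f : BinaryQuartic (ZMod p) =>
        f.a = 0 ∧ f.b = b ∧ f.c = c ∧ f.d = d ∧ f.disc = 0).card ≤ 2 := by
  have h27 : (-27 : ZMod p) * b ^ 4 ≠ 0 := by
    refine mul_ne_zero ?_ (pow_ne_zero _ hb)
    have : (-27 : ZMod p) = -(3 ^ 3) := by norm_num
    rw [this, neg_ne_zero]
    exact pow_ne_zero _ (three_ne_zero_zmod hp3)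
  obtain ⟨P, hP0, hPdeg, hPeval⟩ : ∃ P : (ZMod p)[X], P ≠ 0 ∧ P.natDegree ≤ 2 ∧
      ∀ e, P.eval e = (⟨0, b, c, d, e⟩ : BinaryQuartic (ZMod p)).disc :=
    ⟨C (-27 * b ^ 4) * X ^ 2 + C (18 * b ^ 3 * c * d - 4 * b ^ 2 * c ^ 3) * X
        + C (b ^ 2 * c ^ 2 * d ^ 2 - 4 * b ^ 3 * d ^ 3),
      leadingCoeff_ne_zero.mp (by rw [leadingCoeff_quadratic h27]; exact h27),
      natDegree_quadratic_le,
      fun e => by simp only [disc, eval_add, eval_mul, eval_pow, eval_C, eval_X]; ring⟩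
  calc _ ≤ (univ.filter fun x : ZMod p => P.eval x = 0).card := by
        refine card_le_card_of_injOn (fun f => f.e) (fun f hf => ?_) (fun f hf f' hf' h => ?_)
        · simp only [coe_filter, mem_univ, true_and, Set.mem_setOf_eq] at hf ⊢
          obtain ⟨h₁, h₂, h₃, h₄, hΔ⟩ := hf
          have : f = ⟨0, b, c, d, f.e⟩ := by ext <;> simp [h₁, h₂, h₃, h₄]
          rw [hPeval, ← this, hΔ]
        · simp only [coe_filter, mem_univ, true_and, Set.mem_setOf_eq] at hf hf'
          ext <;> [rw [hf.1, hf'.1]; rw [hf.2.1, hf'.2.1]; rw [hf.2.2.1, hf'.2.2.1];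
            rw [hf.2.2.2.1, hf'.2.2.2.1]; exact h]
    _ ≤ 2 := card_filter_eval_eq_zero_le hP0 hPdeg

/-- The forms over `ℤ/p` with `Δ = 0` and `a ≠ 0` number at most `3p⁴`. [folklore] -/
theorem card_filter_disc_eq_zero_a_ne_zero_le (hp2 : p ≠ 2) :
    (univ.filter fun f : BinaryQuartic (ZMod p) => f.disc = 0 ∧ f.a ≠ 0).card ≤ 3 * p ^ 4 := by
  have key := card_le_mul_card_image_of_maps_to
    (s := univ.filter fun f : BinaryQuartic (ZMod p) => f.disc = 0 ∧ f.a ≠ 0)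
    (t := (univ : Finset (ZMod p × ZMod p × ZMod p × ZMod p)))
    (f := fun f => (f.a, f.b, f.c, f.d)) (fun _ _ => mem_univ _) 3 ?_
  · simpa [Fintype.card_prod, ZMod.card, pow_succ, mul_assoc] using key
  rintro ⟨a, b, c, d⟩ -
  by_cases ha : a = 0
  · -- empty fibre
    rw [Finset.card_eq_zero.mpr, Nat.le_iff_lt_or_eq]
    · exact Or.inl (by norm_num)
    refine filter_eq_empty_iff.mpr fun f hf h => ?_
    rw [mem_filter] at hf
    simp only [Prod.mk.injEq] at h
    exact hf.2.2 (h.1.trans ha)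
  · refine le_trans (card_le_card fun f hf => ?_)
      (card_filter_disc_eq_zero_of_abcd_le_three hp2 ha b c d)
    simp only [mem_filter, mem_univ, true_and, Prod.mk.injEq] at hf ⊢
    exact ⟨hf.2.1, hf.2.2.1, hf.2.2.2.1, hf.2.2.2.2, hf.1.1⟩

/-- The forms over `ℤ/p` with `Δ = 0`, `a = 0`, `b ≠ 0` number at most `2p³`. [folklore] -/
theorem card_filter_disc_eq_zero_a_eq_zero_b_ne_zero_le (hp3 : p ≠ 3) :
    (univ.filter fun f : BinaryQuartic (ZMod p) => f.disc = 0 ∧ f.a = 0 ∧ f.b ≠ 0).card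
      ≤ 2 * p ^ 3 := by
  have key := card_le_mul_card_image_of_maps_to
    (s := univ.filter fun f : BinaryQuartic (ZMod p) => f.disc = 0 ∧ f.a = 0 ∧ f.b ≠ 0)
    (t := (univ : Finset (ZMod p × ZMod p × ZMod p)))
    (f := fun f => (f.b, f.c, f.d)) (fun _ _ => mem_univ _) 2 ?_
  · simpa [Fintype.card_prod, ZMod.card, pow_succ, mul_assoc] using key
  rintro ⟨b, c, d⟩ -
  by_cases hb : b = 0
  · rw [Finset.card_eq_zero.mpr, Nat.le_iff_lt_or_eq]
    · exact Or.inl (by norm_num)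
    refine filter_eq_empty_iff.mpr fun f hf h => ?_
    rw [mem_filter] at hf
    simp only [Prod.mk.injEq] at h
    exact hf.2.2.2 (h.1.trans hb)
  · refine le_trans (card_le_card fun f hf => ?_)
      (card_filter_disc_eq_zero_of_a_eq_zero_le_two hp3 hb c d)
    simp only [mem_filter, mem_univ, true_and, Prod.mk.injEq] at hf ⊢
    exact ⟨hf.1.2.1, hf.2.1, hf.2.2.1, hf.2.2.2, hf.1.1⟩

/-- The forms over `ℤ/p` with `a = b = 0` number `≤ p³` (they all have `Δ = 0`). [folklore] -/
theorem card_filter_a_eq_zero_b_eq_zero_le :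
    (univ.filter fun f : BinaryQuartic (ZMod p) => f.a = 0 ∧ f.b = 0).card ≤ p ^ 3 := by
  have h := card_le_card_of_injOn (s := univ.filter fun f : BinaryQuartic (ZMod p) =>
      f.a = 0 ∧ f.b = 0) (t := (univ : Finset (ZMod p × ZMod p × ZMod p)))
    (fun f => (f.c, f.d, f.e)) (fun _ _ => mem_univ _) ?_
  · simpa [Fintype.card_prod, ZMod.card, pow_succ, mul_assoc] using h
  intro f hf f' hf' h
  simp only [coe_filter, mem_univ, true_and, Set.mem_setOf_eq] at hf hf'
  simp only [Prod.mk.injEq] at h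
  ext <;> [rw [hf.1, hf'.1]; rw [hf.2, hf'.2]; exact h.1; exact h.2.1; exact h.2.2]

/-- The forms over `ℤ/p` (`p ≠ 3`) with `Δ = 0` and `a = 0` number at most `3p³`. [folklore] -/
theorem card_filter_disc_eq_zero_a_eq_zero_le (hp3 : p ≠ 3) :
    (univ.filter fun f : BinaryQuartic (ZMod p) => f.disc = 0 ∧ f.a = 0).card ≤ 3 * p ^ 3 := by
  calc _ ≤ ((univ.filter fun f : BinaryQuartic (ZMod p) => f.disc = 0 ∧ f.a = 0 ∧ f.b ≠ 0) ∪
          (univ.filter fun f : BinaryQuartic (ZMod p) => f.a = 0 ∧ f.b = 0)).card := by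
        refine card_le_card fun f hf => ?_
        simp only [mem_union, mem_filter, mem_univ, true_and] at hf ⊢
        by_cases hb : f.b = 0
        · exact Or.inr ⟨hf.2, hb⟩
        · exact Or.inl ⟨hf.1, hf.2, hb⟩
    _ ≤ 2 * p ^ 3 + p ^ 3 := (card_union_le _ _).trans
        (add_le_add (card_filter_disc_eq_zero_a_eq_zero_b_ne_zero_le hp3)
          card_filter_a_eq_zero_b_eq_zero_le)
    _ = 3 * p ^ 3 := by ring

/-- **The number of `f ∈ V(ℤ/p)` with `Δ(f) = 0` is at most `3p⁴ + 3p³`** (`p ≥ 5`; the exact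
count is `~ p⁴`: `Δ = 0` is a hypersurface). [folklore] -/
theorem card_filter_disc_eq_zero_le (hp5 : 5 ≤ p) :
    (univ.filter fun f : BinaryQuartic (ZMod p) => f.disc = 0).card ≤ 3 * p ^ 4 + 3 * p ^ 3 := by
  have hp2 : p ≠ 2 := by omega
  have hp3 : p ≠ 3 := by omega
  calc _ ≤ ((univ.filter fun f : BinaryQuartic (ZMod p) => f.disc = 0 ∧ f.a ≠ 0) ∪
          (univ.filter fun f : BinaryQuartic (ZMod p) => f.disc = 0 ∧ f.a = 0)).card := by
        refine card_le_card fun f hf => ?_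
        simp only [mem_union, mem_filter, mem_univ, true_and] at hf ⊢
        by_cases ha : f.a = 0
        · exact Or.inr ⟨hf, ha⟩
        · exact Or.inl ⟨hf, ha⟩
    _ ≤ 3 * p ^ 4 + 3 * p ^ 3 := (card_union_le _ _).trans
        (add_le_add (card_filter_disc_eq_zero_a_ne_zero_le hp2)
          (card_filter_disc_eq_zero_a_eq_zero_le hp3))

/-! ## The strata of `Y = {Δ = ∂Δ/∂e = 0}` over `ℤ/p` -/

/-- The stratum `{a ≠ 0, I = 0, J = 0}` (forms with a root of multiplicity `≥ 3`) has at most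
`2p³` points over `ℤ/p`, `p ≥ 5`: for fixed `(a, b, c)` with `a ≠ 0`, `I = 0` determines `e` from
`d` (`12ae = 3bd − c²`) and then `12a·J = Q(d)` is a quadratic in `d` with leading coefficient
`−324a²` (`twelve_mul_a_mul_J`). [folklore] -/
theorem card_filter_I_eq_zero_J_eq_zero_le (hp5 : 5 ≤ p) :
    (univ.filter fun f : BinaryQuartic (ZMod p) => f.a ≠ 0 ∧ f.I = 0 ∧ f.J = 0).card
      ≤ 2 * p ^ 3 := by
  have hp2 : p ≠ 2 := by omega
  have hp3 : p ≠ 3 := by omega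
  have h2 := two_ne_zero_zmod hp2
  have h3 := three_ne_zero_zmod hp3
  have key := card_le_mul_card_image_of_maps_to
    (s := univ.filter fun f : BinaryQuartic (ZMod p) => f.a ≠ 0 ∧ f.I = 0 ∧ f.J = 0)
    (t := (univ : Finset (ZMod p × ZMod p × ZMod p)))
    (f := fun f => (f.a, f.b, f.c)) (fun _ _ => mem_univ _) 2 ?_
  · simpa [Fintype.card_prod, ZMod.card, pow_succ, mul_assoc] using key
  rintro ⟨a, b, c⟩ -
  by_cases ha : a = 0
  · rw [Finset.card_eq_zero.mpr, Nat.le_iff_lt_or_eq]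
    · exact Or.inl (by norm_num)
    refine filter_eq_empty_iff.mpr fun f hf h => ?_
    rw [mem_filter] at hf
    simp only [Prod.mk.injEq] at h
    exact hf.2.1 (h.1.trans ha)
  -- the quadratic `Q(d)`
  have h324 : (-324 : ZMod p) * a ^ 2 ≠ 0 := by
    refine mul_ne_zero ?_ (pow_ne_zero _ ha)
    have : (-324 : ZMod p) = -(2 ^ 2 * 3 ^ 4) := by norm_num
    rw [this, neg_ne_zero]
    exact mul_ne_zero (pow_ne_zero _ h2) (pow_ne_zero _ h3)
  have h12 : (12 : ZMod p) * a ≠ 0 := by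
    refine mul_ne_zero ?_ ha
    have : (12 : ZMod p) = 2 ^ 2 * 3 := by norm_num
    rw [this]
    exact mul_ne_zero (pow_ne_zero _ h2) h3
  set Q : (ZMod p)[X] := C (-324 * a ^ 2) * X ^ 2 + C (324 * a * b * c - 81 * b ^ 3) * X
    + C (27 * b ^ 2 * c ^ 2 - 96 * a * c ^ 3) with hQ
  have hQ0 : Q ≠ 0 := leadingCoeff_ne_zero.mp (by rw [leadingCoeff_quadratic h324]; exact h324)
  calc _ ≤ (univ.filter fun x : ZMod p => Q.eval x = 0).card := by
        refine card_le_card_of_injOn (fun f => f.d) (fun f hf => ?_) (fun f hf f' hf' h => ?_)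
        · simp only [coe_filter, mem_univ, true_and, Set.mem_setOf_eq, mem_filter,
            Prod.mk.injEq] at hf ⊢
          obtain ⟨⟨-, hI, hJ⟩, rfl, rfl, rfl⟩ := hf
          simp only [hQ, eval_add, eval_mul, eval_pow, eval_C, eval_X]
          have := twelve_mul_a_mul_J f
          rw [hI, hJ] at this
          linear_combination -this
        · simp only [coe_filter, mem_filter, mem_univ, true_and, Set.mem_setOf_eq,
            Prod.mk.injEq] at hf hf'
          obtain ⟨⟨-, hI, -⟩, rfl, rfl, rfl⟩ := hf
          obtain ⟨⟨-, hI', -⟩, ha', hb', hc'⟩ := hf'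
          have he : f.e = f'.e := by
            -- `12 a e = 3 b d − c²` on both sides
            simp only [I] at hI hI'
            have h1 : (12 * f.a) * (f.e - f'.e) = 0 := by
              simp only at h
              rw [ha', hb', hc', ← h] at hI'
              linear_combination hI - hI'
            rcases mul_eq_zero.mp h1 with h1 | h1
            · exact absurd h1 h12
            · exact sub_eq_zero.mp h1
          ext <;> [exact ha'.symm; exact hb'.symm; exact hc'.symm; exact h; exact he]
    _ ≤ 2 := card_filter_eval_eq_zero_le hQ0 natDegree_quadratic_le

/-- The square stratum `{a ≠ 0, 8a²d = b(4ac − b²), 64a³e = (4ac − b²)²}` (forms `a·q²`) has at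
most `p³` points over `ℤ/p`, `p ≠ 2`: `(a, b, c)` determine `d` and `e`. [folklore] -/
theorem card_filter_sq_stratum_le (hp2 : p ≠ 2) :
    (univ.filter fun f : BinaryQuartic (ZMod p) => f.a ≠ 0 ∧
        8 * f.a ^ 2 * f.d = f.b * (4 * f.a * f.c - f.b ^ 2) ∧
        64 * f.a ^ 3 * f.e = (4 * f.a * f.c - f.b ^ 2) ^ 2).card ≤ p ^ 3 := by
  have h2 := two_ne_zero_zmod hp2
  have h := card_le_card_of_injOn (s := univ.filter fun f : BinaryQuartic (ZMod p) => f.a ≠ 0 ∧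
        8 * f.a ^ 2 * f.d = f.b * (4 * f.a * f.c - f.b ^ 2) ∧
        64 * f.a ^ 3 * f.e = (4 * f.a * f.c - f.b ^ 2) ^ 2)
    (t := (univ : Finset (ZMod p × ZMod p × ZMod p)))
    (fun f => (f.a, f.b, f.c)) (fun _ _ => mem_univ _) ?_
  · simpa [Fintype.card_prod, ZMod.card, pow_succ, mul_assoc] using h
  intro f hf f' hf' h
  simp only [coe_filter, mem_univ, true_and, Set.mem_setOf_eq] at hf hf'
  simp only [Prod.mk.injEq] at h
  obtain ⟨ha, hd, he⟩ := hf
  obtain ⟨-, hd', he'⟩ := hf'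
  obtain ⟨h₁, h₂, h₃⟩ := h
  rw [← h₁, ← h₂, ← h₃] at hd' he'
  have h8 : (8 : ZMod p) * f.a ^ 2 ≠ 0 := by
    refine mul_ne_zero ?_ (pow_ne_zero _ ha)
    have : (8 : ZMod p) = 2 ^ 3 := by norm_num
    rw [this]; exact pow_ne_zero _ h2
  have h64 : (64 : ZMod p) * f.a ^ 3 ≠ 0 := by
    refine mul_ne_zero ?_ (pow_ne_zero _ ha)
    have : (64 : ZMod p) = 2 ^ 6 := by norm_num
    rw [this]; exact pow_ne_zero _ h2
  ext
  · exact h₁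
  · exact h₂
  · exact h₃
  · have : (8 * f.a ^ 2) * (f.d - f'.d) = 0 := by linear_combination hd - hd'
    rcases mul_eq_zero.mp this with h | h
    · exact absurd h h8
    · exact sub_eq_zero.mp h
  · have : (64 * f.a ^ 3) * (f.e - f'.e) = 0 := by linear_combination he - he'
    rcases mul_eq_zero.mp this with h | h
    · exact absurd h h64
    · exact sub_eq_zero.mp h

/-- **`Y(ℤ/p) ∩ {a ≠ 0}` lies in the union of the two strata** (`I = J = 0` or square), by the
structure theorem `strata_of_disc_eq_zero_of_discDerivE_eq_zero` applied in an algebraic closure of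
`ℤ/p` (`p ≠ 2`). [folklore] -/
theorem strata_of_disc_eq_zero_of_discDerivE_eq_zero_zmod (hp2 : p ≠ 2)
    (f : BinaryQuartic (ZMod p)) (ha : f.a ≠ 0) (hΔ : f.disc = 0) (hΔe : f.discDerivE = 0) :
    (f.I = 0 ∧ f.J = 0) ∨
      (8 * f.a ^ 2 * f.d = f.b * (4 * f.a * f.c - f.b ^ 2) ∧
        64 * f.a ^ 3 * f.e = (4 * f.a * f.c - f.b ^ 2) ^ 2) := by
  set ι := algebraMap (ZMod p) (AlgebraicClosure (ZMod p)) with hι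
  have hinj : Function.Injective ι := ι.injective
  have h2 : (2 : AlgebraicClosure (ZMod p)) ≠ 0 := by
    rw [← map_ofNat ι 2]
    exact (map_ne_zero_iff ι hinj).mpr (two_ne_zero_zmod hp2)
  have key := strata_of_disc_eq_zero_of_discDerivE_eq_zero h2 (f.map ι)
    (by rw [map_a]; exact (map_ne_zero_iff ι hinj).mpr ha)
    (by rw [disc_map, hΔ, map_zero]) (by rw [discDerivE_map, hΔe, map_zero])
  rw [I_map, J_map, map_eq_zero_iff ι hinj, map_eq_zero_iff ι hinj] at key
  simp only [map_a, map_b, map_c, map_d, map_e] at key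
  refine key.imp id fun h => ⟨hinj ?_, hinj ?_⟩
  · simp only [map_mul, map_pow, map_sub, map_ofNat]; exact h.1
  · simp only [map_mul, map_pow, map_sub, map_ofNat]; exact h.2

/-- **`#Y(ℤ/p) ≤ 6p³` for `p ≥ 5`**, `Y = {Δ = ∂Δ/∂e = 0} ⊆ V ≅ 𝔸⁵` — the quantitative form of
"`Y` is the codimension 2 subscheme of `V` defined by the vanishing of `Δ` and `∂Δ/∂e`"
(Bhargava–Shankar 2015, §2.6, the input to Thm 2.18 via the geometric sieve Thm 2.17, whose proof
consumes exactly the bound `#Y(𝔽_p) = O(p^{dim Y})`). Assembled from `#{a = 0, Δ = 0} ≤ 3p³`,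
`#{a ≠ 0, I = J = 0} ≤ 2p³` and `#{square stratum} ≤ p³`. [cite: BhargavaShankarAnnals2015, §2.6, paragraph after Thm 2.18 (published numbering)] -/
theorem card_filter_disc_eq_zero_discDerivE_eq_zero_le (hp5 : 5 ≤ p) :
    (univ.filter fun f : BinaryQuartic (ZMod p) => f.disc = 0 ∧ f.discDerivE = 0).card
      ≤ 6 * p ^ 3 := by
  have hp2 : p ≠ 2 := by omega
  have hp3 : p ≠ 3 := by omega
  calc _ ≤ ((univ.filter fun f : BinaryQuartic (ZMod p) => f.disc = 0 ∧ f.a = 0) ∪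
          ((univ.filter fun f : BinaryQuartic (ZMod p) => f.a ≠ 0 ∧ f.I = 0 ∧ f.J = 0) ∪
          (univ.filter fun f : BinaryQuartic (ZMod p) => f.a ≠ 0 ∧
            8 * f.a ^ 2 * f.d = f.b * (4 * f.a * f.c - f.b ^ 2) ∧
            64 * f.a ^ 3 * f.e = (4 * f.a * f.c - f.b ^ 2) ^ 2))).card := by
        refine card_le_card fun f hf => ?_
        simp only [mem_union, mem_filter, mem_univ, true_and] at hf ⊢
        by_cases ha : f.a = 0
        · exact Or.inl ⟨hf.1, ha⟩
        · exact Or.inr ((strata_of_disc_eq_zero_of_discDerivE_eq_zero_zmod hp2 f ha hf.1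
            hf.2).imp (fun h => ⟨ha, h⟩) (fun h => ⟨ha, h⟩))
    _ ≤ 3 * p ^ 3 + (2 * p ^ 3 + p ^ 3) := (card_union_le _ _).trans
        (add_le_add (card_filter_disc_eq_zero_a_eq_zero_le hp3) ((card_union_le _ _).trans
          (add_le_add (card_filter_I_eq_zero_J_eq_zero_le hp5) (card_filter_sq_stratum_le hp2))))
    _ = 6 * p ^ 3 := by ring

end ZModP

end BinaryQuartic

end Literature.NumberTheory.EllipticCurves

end
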